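/-
Origin: expansion seat `planner-pub-hodgecm-toy-g2-0`, handover #24 2026-08-18T08:56:26Z (`HOME/pub-hodgecm-toy-g2/lean/ToyG2/HodgeRieszBlock.lean`, md5 a96803e1, 119 lines);
landed by the gen-7 packager in gate run 27 as `HodgeCM/Model/ToyG2/HodgeRieszBlock.lean` (import ^import ToyG2\.→import HodgeCM.Model.ToyG2. ×1).
-/
/-
# HodgeCM.Model.ToyG2.HodgeRieszBlock — `HodgeRiesz` for a single good period block (G3, the `pms` itself)

Generation 2 of the `pub-hodgecm-toy` lineage (seat `planner-pub-hodgecm-toy-g2-0`), DESIGN.md §9 (G3).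

For the period surface `pbObj p` (`dim = 2`, `H⁴ = ⋀⁴ L` of rank 70 with trace `ℓ = p.ℓ`), the complementary degree is
`2 · (dim − 2) = 0`, the left radical of the trace pairing `⋀⁴ × ⋀⁰ → ℚ` is `ker ℓ`, so a functional `lam` killing it is a
multiple `λ · ℓ`, represented by the degree-0 class `c = λ · 1`, which is a Hodge class of type (0,0) because the weight
operator is the identity in degree 0 (`Obj.wt_deg_zero`).  Main result: **`hodgeRiesz_pbObj`**; with
`HodgeRieszFree.lean` the hypothesis h2 of `toyUniverse₃_modelAxioms_of'` now holds for every block-free object and for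
every single good block — what remains of G3 is the mixed case (products containing a block and something else).
-/
import Mathlib
import Summits.HodgeConjecture.HodgeCM.Model.ToyG2.HodgeRieszFree

namespace HodgeCM.ToyG2

open HodgeCM.Toy HodgeCM.Toy.CMPresentation
open Literature.AlgebraicGeometry.Motives
open scoped TensorProduct
open exteriorPower Obj₂

noncomputable section

/-! ### §1 Degree zero -/

section Zero

variable (R M : Type*) [CommRing R] [AddCommGroup M] [Module R M]

/-- the unit class `1 ∈ ⋀⁰ M` -/
def one0 : ⋀[R]^0 M := ιMulti R 0 ![]

/-- (Ported verbatim from the HodgeCMPerL package; no docstring in the source.) -/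
lemma one0_coe : ((one0 R M : ⋀[R]^0 M) : ExteriorAlgebra R M) = 1 := by
  rw [one0, ιMulti_apply_coe, ExteriorAlgebra.ιMulti_zero_apply]

variable {R M}

/-- (Ported verbatim from the HodgeCMPerL package; no docstring in the source.) -/
lemma ιMulti_zero_eq_one0 (v : Fin 0 → M) : ιMulti R 0 v = one0 R M := by
  rw [one0]
  congr 1
  funext i
  exact i.elim0

/-- `⋀⁰ M` is the line spanned by `1` -/
lemma exists_eq_smul_one0 (c : ⋀[R]^0 M) : ∃ r : R, c = r • one0 R M := by
  have hc : c ∈ Submodule.span R (Set.range (ιMulti R 0 (M := M))) := by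
    rw [exteriorPower.ιMulti_span]
    trivial
  have hr : Set.range (ιMulti R 0 (M := M)) = {one0 R M} := by
    ext w
    simp only [Set.mem_range, Set.mem_singleton_iff]
    constructor
    · rintro ⟨v, rfl⟩
      exact ιMulti_zero_eq_one0 v
    · rintro rfl
      exact ⟨![], rfl⟩
  rw [hr, Submodule.mem_span_singleton] at hc
  obtain ⟨r, hr'⟩ := hc
  exact ⟨r, hr'.symm⟩

/-- wedging with `1` -/
lemma wedge_one0 {k : ℕ} (y : ⋀[R]^k M) : wedge R M k 0 y (one0 R M) = y := by
  apply Subtype.ext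
  rw [wedge_coe, one0_coe, mul_one]

end Zero

/-- the weight operator is the identity in degree 0 -/
lemma Obj.wt_deg_zero (A : Obj) (z : ℂ) : A.wt z 0 = LinearMap.id := by
  refine exteriorPower.linearMap_ext (AlternatingMap.ext fun v => ?_)
  simp only [LinearMap.compAlternatingMap_apply, Obj.wt, map_apply_ιMulti, LinearMap.id_apply]
  congr 1
  funext i
  exact i.elim0

/-! ### §2 `HodgeRiesz` for a single good block -/

/-- **G3 for the period surface.** -/
theorem hodgeRiesz_pbObj {p : PLeaf} (hp : (Leaf.pb p).Good) : HodgeRiesz (pbObj p) := by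
  intro lam _hlam hrad
  -- `(pbObj p).dim = 2` holds by `rfl`, so the degrees `2 * (dim - 2)` and `4 + 2 * (dim - 2)` are
  -- definitionally `0` and `4`; we keep them symbolic and use `change` where needed.
  -- a vector with `ℓ ≠ 0`
  obtain ⟨x₀, hx₀⟩ : ∃ x₀, p.ℓ x₀ ≠ 0 := by
    by_contra h
    push Not at h
    exact hp.1 (LinearMap.ext fun x => h x)
  -- `lam` kills `ker ℓ` (the left radical)
  have hkerA : ∀ y, p.ℓ y = 0 → lam y = 0 := by
    intro y hy
    apply hrad y
    rw [mem_leftRad]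
    intro c
    obtain ⟨r, rfl⟩ := exists_eq_smul_one0 c
    change trOf (pbObj p) 4 (wedge ℚ (pbObj p).L 4 0 y (r • one0 ℚ (pbObj p).L)) = 0
    rw [map_smul, map_smul, wedge_one0, trOf_pbObj, hy, smul_zero]
  -- hence `lam = λ • ℓ`
  have hform : ∀ y, lam y = (lam x₀ / p.ℓ x₀) * p.ℓ y := by
    intro y
    have h1 : p.ℓ (y - (p.ℓ y / p.ℓ x₀) • x₀) = 0 := by
      rw [map_sub, map_smul, smul_eq_mul, div_mul_cancel₀ _ hx₀, sub_self]
    have h2 := hkerA _ h1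
    rw [map_sub, map_smul, smul_eq_mul, sub_eq_zero] at h2
    rw [h2]
    ring
  refine ⟨(lam x₀ / p.ℓ x₀) • one0 ℚ (pbObj p).L, ?_, fun y => ?_⟩
  · refine Submodule.smul_mem _ _ ?_
    refine (pbObj p).toObj.mem_hodgeClasses_of_wt_two (m := (pbObj p).dim - 2) ?_
    change (pbObj p).toObj.wt 2 0 ((pbObj p).toObj.Θ 0 (HodgeStructure.ofRat (one0 ℚ (pbObj p).L)))
      = (2 : ℂ) ^ 0 • (pbObj p).toObj.Θ 0 (HodgeStructure.ofRat (one0 ℚ (pbObj p).L))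
    rw [Obj.wt_deg_zero, LinearMap.id_apply, pow_zero, one_smul]
  · change lam y = trOf (pbObj p) 4 (wedge ℚ (pbObj p).L 4 0 y ((lam x₀ / p.ℓ x₀) • one0 ℚ (pbObj p).L))
    rw [map_smul, map_smul, wedge_one0, trOf_pbObj, smul_eq_mul]
    exact hform y

end

end HodgeCM.ToyG2
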